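import Summits.FinalStateConjecture.FinalStateConjecture.Theorems.ClusterCompletenessOmegaLimitMultiKerrTranslateCompactness
import Literature.Geometry.Lorentzian.SpacetimeChartDeviationTransfer
import HarnessLib

/-!
# Route ClusterCompleteness · crux `OmegaLimitMultiKerr` — a UNIQUE `Cᵏ_loc` ω-limit of the
# late-time translates forces full convergence of the translates (Hale: `ω(γ) = {q} ⇒ φ(t, p) → q`)

Structure lemma for the crux stmt-FinalStateConjecture-14664 (`ClusterCompleteness.OmegaLimitMultiKerr`,
rank 9), line `Sketch`, lead gen 5, registered stub
`tendsto_supCkENorm_translate_sub_of_forall_omegaLimit_eq` (closed form).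

The LaSalle reading of the crux (`Cruxes/OmegaLimitMultiKerr/Lines/Sketch.md`): the late-time
translates `x ↦ h (x + t • e)` of a chart field `h` (`C^{k+1}` on an open domain `O ⊆ E` invariant
under translation by the Killing direction `e`) of a TAME development — all-late-time `C^{k+1}`
bounds on every compact — have `Cᵏ_loc` ω-limits along every sequence of times `Tₙ → +∞`
(`exists_strictMono_tendsto_supCkENorm_translate_sub`, `…TranslateCompactness`). The
identification step of the dictionary should say that EVERY such ω-limit is the reference
configuration `g₀` (for the deviation from the reference Kerr chart metric: `g₀ = 0`, "the only dark
limit is Kerr"). This file proves the elementary dynamical consequence, Hale 1980, Ch. I, §8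
(proof of Thm. 8.1 / Lemma 8.2: if the ω-limit set of a precompact positive semi-orbit is the single
point `q`, then `φ(t, p) → q` as `t → +∞`), in the `supCkENorm`-on-compacts currency of the tree:

* `tendsto_supCkENorm_translate_sub_of_forall_omegaLimit_eq` (registered stub) — if every `Cᵏ_loc`
  ω-limit `g` of the translates of `h` coincides with `g₀` on `O`, then the translates converge to
  `g₀` in `Cᵏ` on every compact `K ⊆ O` as `t → +∞` THROUGH THE REALS (not only along a
  subsequence): `supCkENorm K k (h (· + t • e) − g₀) → 0`. In crux terms: eventual `Cᵏ`-closeness to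
  the reference configuration at every radius, which is stronger than recurrence.
* `tendsto_supCkENorm_translate_of_forall_omegaLimit_eq_zero` — the `g₀ = 0` reading for deviations.

Proof: the subsequence principle (`Filter.tendsto_of_subseq_tendsto`: a function converges along a
countably generated filter iff every sequence tending to the filter has a subsequence along which it
converges) and compactness: given times `tₙ → +∞`, tameness feeds the `Cᵏ` Arzelà–Ascoli theorem for
translates, which extracts a subsequence converging on compacts to some `Cᵏ` field `g`; uniqueness
identifies `g` with `g₀` on the open set `O ⊇ K`, and the `Cᵏ` sup norm over `K` only sees germs at
points of `K` (`supCkENorm_congr`). Everything is proved; Mathlib + the landed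
`…TranslateCompactness` / `SpacetimeChartDeviationTransfer` files only; no definitions.

## References
* J. K. Hale, *Ordinary Differential Equations*, 2nd ed., Krieger 1980, Ch. I §8, Thm. 8.1 and
  Lemma 8.2 (ω-limit sets of bounded orbits; a one-point ω-limit set is the limit). [Hale1980]
* P. Petersen, *Riemannian Geometry*, 2nd ed., GTM 171, Springer 2006, Ch. 10, §3.1
  (`Cᵏ` Arzelà–Ascoli). [Petersen2006]
-/

-- every `Summit.FinalStateConjecture.FinalStateConjecture.…` name repeats the summit = sub-problem segment (D-0017 layout)
set_option linter.dupNamespace false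

noncomputable section

open Set Filter Topology Function
open scoped ContDiff Topology ENNReal

namespace Summit.FinalStateConjecture.FinalStateConjecture.Theorems.ClusterCompleteness

open Literature.Geometry.Lorentzian

/-- **A unique `Cᵏ_loc` ω-limit forces convergence of the translates** (registered structure stub
of line `Sketch`, crux stmt-FinalStateConjecture-14664; closed form). Let `O ⊆ E` be open and
invariant under the translations `x ↦ x + s • e` (`s ∈ ℝ`), `h : E → W` of class `C^{k+1}` on `O`
and TAME along `e`: on every compact `K ⊆ O` the derivatives of order `≤ k + 1` of `h` at the
translated points `z + t • e`, `z ∈ K`, are bounded uniformly for all late times `t ≥ a`. If every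
`Cᵏ_loc` ω-limit of the translates — every `Cᵏ` field `g` on `O` with
`supCkENorm K k (h (· + Tₙ • e) − g) → 0` on all compacts `K ⊆ O` along some `Tₙ → +∞` — agrees
with `g₀` on `O`, then `supCkENorm K k (h (· + t • e) − g₀) → 0` as `t → +∞` for every compact
`K ⊆ O`. Hale 1980, Ch. I, §8 (a precompact semi-orbit whose ω-limit set is one point converges to
it), via the subsequence principle and the `Cᵏ` Arzelà–Ascoli theorem for translates
(`exists_strictMono_tendsto_supCkENorm_translate_sub`). [cite: Hale1980, Ch. I §8 Thm. 8.1] -/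
theorem tendsto_supCkENorm_translate_sub_of_forall_omegaLimit_eq :
    ∀ {E : Type*} [NormedAddCommGroup E] [NormedSpace ℝ E] [FiniteDimensional ℝ E]
      {W : Type*} [NormedAddCommGroup W] [NormedSpace ℝ W] [FiniteDimensional ℝ W]
      {O : Set E} {e : E}, IsOpen O → (∀ x ∈ O, ∀ s : ℝ, x + s • e ∈ O) →
      ∀ {k : ℕ} {h : E → W}, ContDiffOn ℝ (k + 1) h O →
      (∀ K ⊆ O, IsCompact K → ∃ Λ a : ℝ, ∀ t : ℝ, a ≤ t → ∀ i, i ≤ k + 1 → ∀ z ∈ K,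
        ‖iteratedFDeriv ℝ i h (z + t • e)‖ ≤ Λ) →
      ∀ (g₀ : E → W), (∀ (g : E → W) (T : ℕ → ℝ), ContDiffOn ℝ k g O → Tendsto T atTop atTop →
        (∀ K ⊆ O, IsCompact K →
          Tendsto (fun n ↦ supCkENorm K k (fun x ↦ h (x + T n • e) - g x)) atTop (𝓝 0)) →
        ∀ x ∈ O, g x = g₀ x) →
      ∀ K ⊆ O, IsCompact K →
        Tendsto (fun t : ℝ ↦ supCkENorm K k (fun x ↦ h (x + t • e) - g₀ x)) atTop (𝓝 0) := by
  intro E _ _ _ W _ _ _ O e hO hOe k h hh htame g₀ huniq K hKO hK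
  -- subsequence principle: every sequence of times `ns → +∞` has a good subsequence
  refine Filter.tendsto_of_subseq_tendsto fun ns hns ↦ ?_
  -- nonnegative times `T n = max (ns n) 0`, eventually equal to `ns n`
  obtain ⟨T, hT0, hTge, hTns⟩ : ∃ T : ℕ → ℝ, (∀ n, 0 ≤ T n) ∧ (∀ n, ns n ≤ T n) ∧
      ∀ᶠ n in atTop, T n = ns n := by
    refine ⟨fun n ↦ max (ns n) 0, fun n ↦ le_max_right _ _, fun n ↦ le_max_left _ _, ?_⟩
    filter_upwards [hns.eventually_ge_atTop 0] with n hn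
    exact max_eq_left hn
  have hT : Tendsto T atTop atTop := tendsto_atTop_mono hTge hns
  -- forward invariance of `O` and eventual uniform `C^{k+1}` bounds along `T` (tameness)
  have hOe' : ∀ x ∈ O, ∀ s : ℝ, 0 ≤ s → x + s • e ∈ O := fun x hx s _ ↦ hOe x hx s
  have hb : ∀ K ⊆ O, IsCompact K → ∃ Λ : ℝ, ∀ᶠ n in atTop, ∀ i, i ≤ k + 1 → ∀ z ∈ K,
      ‖iteratedFDeriv ℝ i h (z + T n • e)‖ ≤ Λ := by
    intro K' hK'O hK'
    obtain ⟨Λ, a, hΛ⟩ := htame K' hK'O hK'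
    refine ⟨Λ, ?_⟩
    filter_upwards [tendsto_atTop.1 hT a] with n hn
    exact hΛ (T n) hn
  -- `Cᵏ` Arzelà–Ascoli for the translates: an ω-limit `g` along a subsequence `φ`
  obtain ⟨g, φ, hφ, hg, hconv⟩ :=
    exists_strictMono_tendsto_supCkENorm_translate_sub hO hOe' hh hT0 hb
  -- uniqueness: `g = g₀` on `O`
  have hgg₀ : ∀ x ∈ O, g x = g₀ x :=
    huniq g (fun n ↦ T (φ n)) hg (hT.comp hφ.tendsto_atTop) fun K' hK'O hK' ↦ hconv K' hK'O hK'
  -- the sup norm over `K ⊆ O` only sees the germs at points of `K`, where `g` and `g₀` agree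
  have hcongr : ∀ n, supCkENorm K k (fun x ↦ h (x + T (φ n) • e) - g₀ x) =
      supCkENorm K k (fun x ↦ h (x + T (φ n) • e) - g x) := by
    intro n
    refine supCkENorm_congr fun x hx ↦ ?_
    filter_upwards [hO.mem_nhds (hKO hx)] with y hy
    rw [hgg₀ y hy]
  have hlim : Tendsto (fun n ↦ supCkENorm K k (fun x ↦ h (x + T (φ n) • e) - g₀ x)) atTop
      (𝓝 0) := by
    simp_rw [hcongr]
    exact hconv K hKO hK
  -- transfer from the times `T (φ n)` to `ns (φ n)` (eventually equal)
  refine ⟨φ, hlim.congr' ?_⟩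
  filter_upwards [hφ.tendsto_atTop.eventually hTns] with n hn
  simp only [hn]

/-- **The `g₀ = 0` reading: if the only `Cᵏ_loc` ω-limit of the translates is zero, the translates
tend to zero in `Cᵏ` on every compact.** Same setting as
`tendsto_supCkENorm_translate_sub_of_forall_omegaLimit_eq` (open `O` invariant under translation by
`e`, `h` of class `C^{k+1}` on `O` and tame along `e`); if every `Cᵏ` field `g` on `O` arising as a
`Cᵏ_loc` limit of translates `h (· + Tₙ • e)`, `Tₙ → +∞`, vanishes on `O`, then
`supCkENorm K k (h (· + t • e)) → 0` as `t → +∞` for every compact `K ⊆ O` — for the deviation of a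
late chart metric from the reference Kerr metric: "the only dark limit is Kerr" implies eventual
`Cᵏ`-closeness to Kerr at every radius. Hale 1980, Ch. I, §8. [cite: Hale1980, Ch. I §8 Thm. 8.1] -/
theorem tendsto_supCkENorm_translate_of_forall_omegaLimit_eq_zero
    {E : Type*} [NormedAddCommGroup E] [NormedSpace ℝ E] [FiniteDimensional ℝ E]
    {W : Type*} [NormedAddCommGroup W] [NormedSpace ℝ W] [FiniteDimensional ℝ W]
    {O : Set E} {e : E} (hO : IsOpen O) (hOe : ∀ x ∈ O, ∀ s : ℝ, x + s • e ∈ O)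
    {k : ℕ} {h : E → W} (hh : ContDiffOn ℝ (k + 1) h O)
    (htame : ∀ K ⊆ O, IsCompact K → ∃ Λ a : ℝ, ∀ t : ℝ, a ≤ t → ∀ i, i ≤ k + 1 → ∀ z ∈ K,
      ‖iteratedFDeriv ℝ i h (z + t • e)‖ ≤ Λ)
    (huniq : ∀ (g : E → W) (T : ℕ → ℝ), ContDiffOn ℝ k g O → Tendsto T atTop atTop →
      (∀ K ⊆ O, IsCompact K →
        Tendsto (fun n ↦ supCkENorm K k (fun x ↦ h (x + T n • e) - g x)) atTop (𝓝 0)) →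
      ∀ x ∈ O, g x = 0)
    (K : Set E) (hKO : K ⊆ O) (hK : IsCompact K) :
    Tendsto (fun t : ℝ ↦ supCkENorm K k (fun x ↦ h (x + t • e))) atTop (𝓝 0) := by
  have := tendsto_supCkENorm_translate_sub_of_forall_omegaLimit_eq hO hOe hh htame 0
    (fun g T hg hT hc ↦ huniq g T hg hT hc) K hKO hK
  simpa only [Pi.zero_apply, sub_zero] using this

end Summit.FinalStateConjecture.FinalStateConjecture.Theorems.ClusterCompleteness

end
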